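import Summits.KontsevichZagierPeriods.KontsevichZagierPeriods.Theses.HurwitzMicroSectors
import Summits.KontsevichZagierPeriods.KontsevichZagierPeriods.Theorems.HurwitzMicroSectorsNormalFormPrinciplePiBoxTransfer
import Summits.KontsevichZagierPeriods.KontsevichZagierPeriods.Theorems.HurwitzMicroSectorsNormalFormPrincipleVariants2238

/-! TTRL-lite variant V2227 of stmt-KontsevichZagierPeriods-3869

Variant V2227 = `stub_boxRigidity` (the leaf `BoxRigidity` of `NormalFormPrinciple`: two representations
on open unit boxes with integrands of KZ's rational shape `p/q` and equal values are KZ-equivalent) under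
the TWO-sided move `fix_nat:m=2; fix_nat:m'=6` (left dimension frozen to `2`, right dimension to `6`).
Verdict of the attempt seat: **open** — this file is the exact-strength certificate, not a proof of the
variant. For every `K` let `BoxVanishing K` say that a box-rational representation of dimension `K` and
value `0` is a relation. A pair of FROZEN dimensions `(K, k)` is exactly `BoxVanishing (max K k)`
(`boxRigidityPair_iff_boxVanishingDim_left/right`, packaging the tree's `boxVanishingDim_left/right_of_pair`,
`boxRigidityLe_of_boxVanishingDim` of `…Variants2238`): compare with the zero representation on the other
box one way; pad both to the larger box (`pad_le`) and subtract there (`sub_same`) the other way. Hence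
`V2227 ⟺ BoxVanishing 6 ⟺ BoxRigidity for all m, m' ≤ 6` (`stub_boxRigidity_var2227_iff_boxVanishing_six`,
`stub_boxRigidity_var2227_iff_le_six`), V2227 gives `BoxVanishing j` for every `j ≤ 6`
(`boxVanishing_le_six_of_stub_boxRigidity_var2227`) and therefore the siblings V2238 (`BoxVanishing 3`)
and, below it, the square (`BoxVanishing 2`). `BoxVanishing 1` is a theorem of the tree
(`boxRigidity_of_le_one`, Baker); from dimension `2` on it is open: `BoxVanishing 5 ∋` "for `a b : ℚ`,
`a + b·ζ(5) = 0 ⇒ [a + b/(1 − x₁⋯x₅)]_{(0,1)⁵}` is a relation", provable today only through the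
irrationality of `ζ(5)` (open) or an explicit chain of moves (none can exist unless `ζ(5) ∈ ℚ`); already
`BoxVanishing 2` contains the same dichotomy for Catalan's `G = ∫∫ dx dy/(1+x²y²)`. Conversely
`KontsevichZagierPeriods → parent → V2227` (`stub_boxRigidity_var2227_of_statement`), so a refutation of
the variant would refute the Summit (Conjecture 1 for the tree's calculus).
Source: M. Kontsevich, D. Zagier, *Periods* (2001), §1.2 Conjecture 1. Pure proof file, no definitions. -/

-- `Summit.<Summit>.<Problem>` is the tree's mandated summit-side namespace (CONVENTIONS §2); for this
-- single-conjunct summit the two coincide, so the duplicate is deliberate.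
set_option linter.dupNamespace false

noncomputable section

namespace Summit.KontsevichZagierPeriods.KontsevichZagierPeriods.Theorems

open MeasureTheory Set
open Literature.NumberTheory.Transcendental Literature.NumberTheory.Transcendental.KZ
open Summit.KontsevichZagierPeriods.KontsevichZagierPeriods.Theses.HurwitzMicroSectors
open Summit.KontsevichZagierPeriods.HurwitzMicroSectors.NormalFormPrinciple.PiBox

/-! ## A pair of frozen dimensions is `BoxVanishing` of the larger one -/

/-- **Rigidity for the pair of dimensions `(K, k)` with `k ≤ K` ⟺ `BoxVanishing K`.**
(⇒) compare with the zero representation on the `k`-box (`boxVanishingDim_left_of_pair`);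
(⇐) pad both representations to the `K`-box and subtract there (`boxRigidityLe_of_boxVanishingDim`).
This settles every sibling `fix_nat:m=K; fix_nat:m'=k` of `stub_boxRigidity` at once.
[cite: KontsevichZagier2001, §1.2 Conjecture 1] -/
theorem boxRigidityPair_iff_boxVanishingDim_left {K k : ℕ} (hkK : k ≤ K) :
    (∀ (N : IntegralRep K) (N' : IntegralRep k),
      N.domain = {x | ∀ i, x i ∈ Set.Ioo (0:ℝ) 1} → N.IsRational →
      N'.domain = {x | ∀ i, x i ∈ Set.Ioo (0:ℝ) 1} → N'.IsRational →
      N.value = N'.value → Equivalent N N') ↔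
    (∀ (M : IntegralRep K), M.domain = {x | ∀ i, x i ∈ Set.Ioo (0:ℝ) 1} → M.IsRational →
      M.value = 0 → of M ∈ relations) :=
  ⟨boxVanishingDim_left_of_pair K k,
    fun hvan N N' => boxRigidityLe_of_boxVanishingDim K hvan K k N N' le_rfl hkK⟩

/-- **Rigidity for the pair of dimensions `(K, k)` with `K ≤ k` ⟺ `BoxVanishing k`** (the same with
the larger dimension on the right: `boxVanishingDim_right_of_pair` one way, padding the other).
[cite: KontsevichZagier2001, §1.2 Conjecture 1] -/
theorem boxRigidityPair_iff_boxVanishingDim_right {K k : ℕ} (hKk : K ≤ k) :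
    (∀ (N : IntegralRep K) (N' : IntegralRep k),
      N.domain = {x | ∀ i, x i ∈ Set.Ioo (0:ℝ) 1} → N.IsRational →
      N'.domain = {x | ∀ i, x i ∈ Set.Ioo (0:ℝ) 1} → N'.IsRational →
      N.value = N'.value → Equivalent N N') ↔
    (∀ (M : IntegralRep k), M.domain = {x | ∀ i, x i ∈ Set.Ioo (0:ℝ) 1} → M.IsRational →
      M.value = 0 → of M ∈ relations) :=
  ⟨boxVanishingDim_right_of_pair K k,
    fun hvan N N' => boxRigidityLe_of_boxVanishingDim k hvan K k N N' hKk le_rfl⟩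

/-- **A frozen pair `(K, k)` is the same statement as the swapped pair `(k, K)`** (symmetry of
`Equivalent`: relations form a subgroup; both are `BoxVanishing` of the larger dimension).
[cite: KontsevichZagier2001, §1.2 Conjecture 1] -/
theorem boxRigidityPair_comm (K k : ℕ) :
    (∀ (N : IntegralRep K) (N' : IntegralRep k),
      N.domain = {x | ∀ i, x i ∈ Set.Ioo (0:ℝ) 1} → N.IsRational →
      N'.domain = {x | ∀ i, x i ∈ Set.Ioo (0:ℝ) 1} → N'.IsRational →
      N.value = N'.value → Equivalent N N') ↔
    (∀ (N : IntegralRep k) (N' : IntegralRep K),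
      N.domain = {x | ∀ i, x i ∈ Set.Ioo (0:ℝ) 1} → N.IsRational →
      N'.domain = {x | ∀ i, x i ∈ Set.Ioo (0:ℝ) 1} → N'.IsRational →
      N.value = N'.value → Equivalent N N') := by
  constructor <;> intro h N N' hNd hNr hN'd hN'r hv <;>
    simpa [Equivalent] using relations.neg_mem (h N' N hN'd hN'r hNd hNr hv.symm)

/-! ## The variant V2227 itself: exactly `BoxVanishing 6` -/

/-- **V2227 ⟺ `BoxVanishing 6`** (instance `K = 2 ≤ 6 = k` of
`boxRigidityPair_iff_boxVanishingDim_right`). [cite: KontsevichZagier2001, §1.2 Conjecture 1] -/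
theorem stub_boxRigidity_var2227_iff_boxVanishing_six :
    (∀ (N : IntegralRep 2) (N' : IntegralRep 6), N.domain = {x | ∀ i, x i ∈ Set.Ioo (0:ℝ) 1} → N.IsRational → N'.domain = {x | ∀ i, x i ∈ Set.Ioo (0:ℝ) 1} → N'.IsRational → N.value = N'.value → Equivalent N N') ↔
    (∀ (M : IntegralRep 6), M.domain = {x | ∀ i, x i ∈ Set.Ioo (0:ℝ) 1} → M.IsRational →
      M.value = 0 → of M ∈ relations) :=
  boxRigidityPair_iff_boxVanishingDim_right (by norm_num)

/-- **V2227 ⟺ `BoxRigidity` for all `m, m' ≤ 6`** (so V2227 coincides with the two-sided variants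
`bound_nat:m≤6; bound_nat:m'≤6` and `fix_nat:m=j; fix_nat:m'=k` for every `max j k = 6`): freezing the
left dimension to `2` rather than `6` loses nothing, by padding. [cite: KontsevichZagier2001, §1.2 Conjecture 1] -/
theorem stub_boxRigidity_var2227_iff_le_six :
    (∀ (N : IntegralRep 2) (N' : IntegralRep 6), N.domain = {x | ∀ i, x i ∈ Set.Ioo (0:ℝ) 1} → N.IsRational → N'.domain = {x | ∀ i, x i ∈ Set.Ioo (0:ℝ) 1} → N'.IsRational → N.value = N'.value → Equivalent N N') ↔
    (∀ (m m' : ℕ) (N : IntegralRep m) (N' : IntegralRep m'), m ≤ 6 → m' ≤ 6 →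
      N.domain = {x | ∀ i, x i ∈ Set.Ioo (0:ℝ) 1} → N.IsRational →
      N'.domain = {x | ∀ i, x i ∈ Set.Ioo (0:ℝ) 1} → N'.IsRational →
      N.value = N'.value → Equivalent N N') := by
  rw [stub_boxRigidity_var2227_iff_boxVanishing_six]
  exact ⟨fun hvan => boxRigidityLe_of_boxVanishingDim 6 hvan,
    fun h => boxVanishingDim_left_of_pair 6 6 fun N N' => h 6 6 N N' le_rfl le_rfl⟩

/-- **V2227 ⇒ `BoxVanishing` in every dimension `≤ 6`** (monotonicity by padding), in particular the
dimension-`5` statement containing the `ζ(5)` dichotomy and the dimension-`2` statement containing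
Catalan's. [cite: KontsevichZagier2001, §1.2 Conjecture 1] -/
theorem boxVanishing_le_six_of_stub_boxRigidity_var2227
    (h : ∀ (N : IntegralRep 2) (N' : IntegralRep 6), N.domain = {x | ∀ i, x i ∈ Set.Ioo (0:ℝ) 1} → N.IsRational → N'.domain = {x | ∀ i, x i ∈ Set.Ioo (0:ℝ) 1} → N'.IsRational → N.value = N'.value → Equivalent N N')
    {j : ℕ} (hj : j ≤ 6) (N : IntegralRep j) (hNd : N.domain = {x | ∀ i, x i ∈ Set.Ioo (0:ℝ) 1})
    (hNr : N.IsRational) (hv : N.value = 0) : of N ∈ relations :=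
  boxVanishingDim_mono hj (stub_boxRigidity_var2227_iff_boxVanishing_six.1 h) N hNd hNr hv

/-- **V2227 ⇒ the sibling V2238** (`fix_nat:m=3; bound_nat:m'≤2`, which is `BoxVanishing 3`): the
two-sided variants are linearly ordered by their largest dimension. [cite: KontsevichZagier2001, §1.2 Conjecture 1] -/
theorem stub_boxRigidity_var2238_of_var2227
    (h : ∀ (N : IntegralRep 2) (N' : IntegralRep 6), N.domain = {x | ∀ i, x i ∈ Set.Ioo (0:ℝ) 1} → N.IsRational → N'.domain = {x | ∀ i, x i ∈ Set.Ioo (0:ℝ) 1} → N'.IsRational → N.value = N'.value → Equivalent N N') :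
    ∀ (m' : ℕ) (N : IntegralRep 3) (N' : IntegralRep m'), m' ≤ 2 → N.domain = {x | ∀ i, x i ∈ Set.Ioo (0:ℝ) 1} → N.IsRational → N'.domain = {x | ∀ i, x i ∈ Set.Ioo (0:ℝ) 1} → N'.IsRational → N.value = N'.value → Equivalent N N' :=
  stub_boxRigidity_var2238_iff_boxVanishing_three.2 fun M hMd hMr hMv =>
    boxVanishing_le_six_of_stub_boxRigidity_var2227 h (by norm_num) M hMd hMr hMv

/-- **The parent leaf ⇒ V2227** (specialisation `m := 2`, `m' := 6`; the converse is not claimed — the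
parent is `BoxVanishing` in ALL dimensions). [cite: KontsevichZagier2001, §1.2 Conjecture 1] -/
theorem stub_boxRigidity_var2227_of_parent
    (h : ∀ (m m' : ℕ) (N : IntegralRep m) (N' : IntegralRep m'), N.domain = {x | ∀ i, x i ∈ Set.Ioo (0:ℝ) 1} → N.IsRational → N'.domain = {x | ∀ i, x i ∈ Set.Ioo (0:ℝ) 1} → N'.IsRational → N.value = N'.value → Equivalent N N') :
    ∀ (N : IntegralRep 2) (N' : IntegralRep 6), N.domain = {x | ∀ i, x i ∈ Set.Ioo (0:ℝ) 1} → N.IsRational → N'.domain = {x | ∀ i, x i ∈ Set.Ioo (0:ℝ) 1} → N'.IsRational → N.value = N'.value → Equivalent N N' :=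
  h 2 6

/-- **`KontsevichZagierPeriods ⇒ V2227`**: the variant is a special case of Conjecture 1 for the tree's
calculus (`leaves_of_statement`) — so a refutation of the variant would refute the Summit.
[cite: KontsevichZagier2001, §1.2 Conjecture 1] -/
theorem stub_boxRigidity_var2227_of_statement (h : _root_.KontsevichZagierPeriods) :
    ∀ (N : IntegralRep 2) (N' : IntegralRep 6), N.domain = {x | ∀ i, x i ∈ Set.Ioo (0:ℝ) 1} → N.IsRational → N'.domain = {x | ∀ i, x i ∈ Set.Ioo (0:ℝ) 1} → N'.IsRational → N.value = N'.value → Equivalent N N' :=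
  stub_boxRigidity_var2227_of_parent (leaves_of_statement h).1

end Summit.KontsevichZagierPeriods.KontsevichZagierPeriods.Theorems

end
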